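import Literature.AlgebraicGeometry.Resolution.FBlowup
import Literature.AlgebraicGeometry.Resolution.FrobeniusNormLocalization
import Literature.AlgebraicGeometry.Resolution.FFinite
import Literature.AlgebraicGeometry.Resolution.BlowupsExistence

/-!
# `WeightedThesis` — existence of F-blowups (Yasuda 2012, Def. 2.2 / Cor. 2.6)

Support file for crux `stmt-ResolutionOfSingularities-0569`, line `kunz-tower-exceptional-defect`,
stub `stub_fblowupExists`: **every integral separated scheme of finite type over a perfect field
of characteristic `p` admits an `e`-th F-blowup** (`IsFBlowup`, `FBlowup.lean`, whose item
"EXISTENCE (`FB_e X` as data)" under "What is NOT here" this file proves, by the gluing pattern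
of `BlowupsExistence.lean`; T. Yasuda, Amer. J. Math. 134 (2012), Def. 2.2 and Cor. 2.6, in the
blow-up form of O. Villamayor U., J. Algebra 295 (2006), Thm. 3.3 and 3.4):

* `frobeniusNorm_eq_span_of_isFFinite`, `exists_isFrobeniusNormIdeal` — the Frobenius norm of an
  F-finite ring is finitely generated, so an F-finite domain has a Frobenius norm IDEAL;
* `isFrobeniusNormIdeal_map_of_le`, `isBlowup_comap_homOfLE` — for affine opens `U ⊆ V`,
  `I_V · Γ(X, U)` is again a Frobenius norm ideal (Villamayor 3.4), so a blowing up of `U` along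
  `Ĩ_U` is one along the restricted centre `Ĩ_V|_U` (`isBlowup_iff_of_span_singleton_mul_eq`);
* `exists_isFBlowup_of_forall_exists_isFrobeniusNormIdeal` — the local blowing ups with the
  transition maps of the universal property form a relative gluing datum over the locally
  directed affine cover (Stacks 01LH) and glue to an `e`-th F-blowup;
* `stub_fblowupExists` — over a perfect field every `Γ(X, U)` is F-finite, so this applies.

Sources: [Yasuda2012] Def. 2.2, Cor. 2.6; [Villamayoru2006] §2, Thm. 3.3, 3.4; [StacksProject]
Tags 01LH, 0806.
-/

noncomputable section

open CategoryTheory CategoryTheory.Limits AlgebraicGeometry TopologicalSpace Module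
open Literature.AlgebraicGeometry.Resolution

set_option linter.dupNamespace false

namespace Summit.ResolutionOfSingularities.ResolutionOfSingularities.Theorems.WeightedThesis.KunzTower

universe u v

section Algebra

variable {K : Type u} [Field K] {p : ℕ} [ExpChar K p] {e : ℕ}
variable {ι : Type v} [Fintype ι] [DecidableEq ι]
variable (β : Basis ι (iterateFrobeniusRange K p e) K)
variable {A : Type*} [CommRing A] [Algebra A K]

/-- **The Frobenius norm of an F-finite ring is finitely generated**: if `A = ∑ⱼ A^q sⱼ` then
`[[F^e_* A]]_β` is the `A`-span of the `q`-th roots `d_σ` of the determinants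
`det_β(s_{σ 1}, …, s_{σ r})`, `σ : ι → Fin n`. [cite: Villamayoru2006, §2 p. 123] -/
theorem frobeniusNorm_eq_span_of_isFFinite {n : ℕ} (s : Fin n → A)
    (hs : ∀ a : A, ∃ c : Fin n → A, a = ∑ j, c j ^ p ^ e * s j) (d : (ι → Fin n) → K)
    (hd : ∀ σ, d σ ^ p ^ e =
      ((β.det fun i => algebraMap A K (s (σ i)) : iterateFrobeniusRange K p e) : K)) :
    frobeniusNorm β A = Submodule.span A (Set.range d) := by
  classical
  refine le_antisymm ?_ ?_
  · rw [frobeniusNorm, Submodule.span_le]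
    rintro x ⟨m, hm⟩
    choose c hc using fun i => hs (m i)
    -- the `K^q`-coefficients
    let c' : ι → Fin n → iterateFrobeniusRange K p e := fun i j =>
      ⟨algebraMap A K (c i j) ^ p ^ e, pow_mem_iterateFrobeniusRange _⟩
    have hmi : ∀ i, algebraMap A K (m i) = ∑ j, c' i j • algebraMap A K (s j) := by
      intro i
      rw [hc i, map_sum]
      refine Finset.sum_congr rfl fun j _ => ?_
      rw [map_mul, map_pow, Algebra.smul_def, Subfield.algebraMap_ofSubfield]
      rfl
    have hdet : ((β.det fun i => algebraMap A K (m i) : iterateFrobeniusRange K p e) : K) =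
        ∑ σ : ι → Fin n, (∏ i, algebraMap A K (c i (σ i)) ^ p ^ e) * d σ ^ p ^ e := by
      have h1 : (fun i => algebraMap A K (m i)) = fun i => ∑ j, c' i j • algebraMap A K (s j) :=
        funext hmi
      rw [h1]
      have h2 := MultilinearMap.map_sum (β.det : MultilinearMap (iterateFrobeniusRange K p e)
        (fun _ : ι => K) (iterateFrobeniusRange K p e))
        (fun i j => c' i j • algebraMap A K (s j))
      rw [AlternatingMap.coe_multilinearMap] at h2
      rw [h2, AddSubmonoidClass.coe_finsetSum]
      refine Finset.sum_congr rfl fun σ _ => ?_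
      have h3 := (β.det : MultilinearMap (iterateFrobeniusRange K p e) (fun _ : ι => K)
        (iterateFrobeniusRange K p e)).map_smul_univ (fun i => c' i (σ i))
        (fun i => algebraMap A K (s (σ i)))
      rw [AlternatingMap.coe_multilinearMap] at h3
      rw [h3, smul_eq_mul, Subfield.coe_mul, SubmonoidClass.coe_finsetProd, hd σ]
    have hx : x = ∑ σ : ι → Fin n, (∏ i, algebraMap A K (c i (σ i))) * d σ := by
      apply pow_expChar_pow_injective (K := K) (p := p) (e := e)
      change x ^ p ^ e = (∑ σ : ι → Fin n, (∏ i, algebraMap A K (c i (σ i))) * d σ) ^ p ^ e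
      rw [hm, hdet, ← iterateFrobenius_def (R := K) (p := p) (n := e), map_sum]
      refine Finset.sum_congr rfl fun σ _ => ?_
      rw [map_mul, map_prod]
      simp only [iterateFrobenius_def]
    rw [hx]
    refine Submodule.sum_mem _ fun σ _ => ?_
    rw [← map_prod, ← Algebra.smul_def]
    exact Submodule.smul_mem _ _ (Submodule.subset_span ⟨σ, rfl⟩)
  · rw [Submodule.span_le]
    rintro _ ⟨σ, rfl⟩
    exact frobeniusNormSet_subset_frobeniusNorm ⟨fun i => s (σ i), hd σ⟩

/-- **F-finite fields are finite over `K^q`**: if `K = ∑ⱼ K^q sⱼ` then `K` is a finite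
`K^q`-vector space. [folklore] -/
theorem finite_iterateFrobeniusRange_of_isFFinite (hK : IsFFinite p e K) :
    Module.Finite (iterateFrobeniusRange K p e) K := by
  classical
  obtain ⟨n, s, hs⟩ := hK
  refine Module.finite_def.mpr ⟨Finset.univ.image s, ?_⟩
  rw [Finset.coe_image, Finset.coe_univ, Set.image_univ, eq_top_iff]
  rintro a -
  obtain ⟨c, hc⟩ := hs a
  rw [hc]
  refine Submodule.sum_mem _ fun i _ => ?_
  have : c i ^ p ^ e * s i =
      (⟨c i ^ p ^ e, pow_mem_iterateFrobeniusRange _⟩ : iterateFrobeniusRange K p e) • s i := by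
    rw [Algebra.smul_def, Subfield.algebraMap_ofSubfield]
    rfl
  rw [this]
  exact Submodule.smul_mem _ _ (Submodule.subset_span ⟨i, rfl⟩)

/-- **F-finite domains have Frobenius norm ideals**: for a domain `A`, F-finite at level `e`,
with fraction field `K` of characteristic `p`, some ideal `I ⊆ A` is a Frobenius norm ideal
`[[F^e_* A]]` — `K` is finite over `K^q`, the norm attached to a basis `β₀` is finitely generated,
a common denominator `v ∈ A` of its generators moves it into `A`, and `v · [[A]]_{β₀} = [[A]]_β`
for `β` obtained by dividing one vector of `β₀` by `v^q`. [cite: Villamayoru2006, §2 p. 123] -/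
theorem exists_isFrobeniusNormIdeal [IsDomain A] [IsFractionRing A K] (hA : IsFFinite p e A) :
    ∃ I : Ideal A, IsFrobeniusNormIdeal K p e I := by
  classical
  haveI : ExpChar A p := RingHom.expChar (algebraMap A K) (IsFractionRing.injective A K) p
  haveI : Module.Finite (iterateFrobeniusRange K p e) K :=
    finite_iterateFrobeniusRange_of_isFFinite (hA.of_isLocalization (nonZeroDivisors A) K)
  -- a basis `β₀` indexed by `Fin r`, `r ≥ 1`
  let β₀ := Module.finBasis (iterateFrobeniusRange K p e) K
  have hr : 0 < Module.finrank (iterateFrobeniusRange K p e) K := Module.finrank_pos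
  let i₀ : Fin (Module.finrank (iterateFrobeniusRange K p e) K) := ⟨0, hr⟩
  -- generators of the norm for `β₀` and a common denominator
  obtain ⟨n, s, hs⟩ := hA
  choose d hd using fun σ : Fin (Module.finrank (iterateFrobeniusRange K p e) K) → Fin n =>
    mem_iterateFrobeniusRange_iff.mp (β₀.det fun i => algebraMap A K (s (σ i))).2
  have hN₀ : frobeniusNorm β₀ A = Submodule.span A (Set.range d) :=
    frobeniusNorm_eq_span_of_isFFinite β₀ s hs d hd
  obtain ⟨b, hb⟩ := IsLocalization.exist_integer_multiples_of_finite (nonZeroDivisors A) d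
  choose a ha using hb
  let v : K := algebraMap A K (b : A)
  have hv : v ≠ 0 := IsFractionRing.to_map_ne_zero_of_mem_nonZeroDivisors b.2
  -- rescale one vector of `β₀` by `(v^q)⁻¹`
  let u : (iterateFrobeniusRange K p e)ˣ :=
    Units.mk0 ⟨v ^ p ^ e, pow_mem_iterateFrobeniusRange v⟩ fun h =>
      pow_ne_zero _ hv (congrArg Subtype.val h)
  let w : Fin (Module.finrank (iterateFrobeniusRange K p e) K) → (iterateFrobeniusRange K p e)ˣ :=
    Function.update 1 i₀ u⁻¹
  let β := β₀.unitsSMul w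
  have hw : ∏ i, w i = u⁻¹ := by
    rw [Finset.prod_update_of_mem (Finset.mem_univ i₀)]
    simp
  have hβ : v ^ p ^ e = ((β.det β₀ : iterateFrobeniusRange K p e) : K) := by
    rw [Module.Basis.det_unitsSMul, AlternatingMap.smul_apply, β₀.det_self, hw, inv_inv,
      smul_eq_mul, mul_one]
    rfl
  have hN : frobeniusNorm β A = (frobeniusNorm β₀ A).map (LinearMap.mulLeft A v) :=
    frobeniusNorm_basis_change (β := β₀) β hβ
  have hva : ∀ σ, algebraMap A K (a σ) = v * d σ := fun σ => by rw [ha σ, Algebra.smul_def]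
  -- the ideal generated by the numerators `a σ` of `v d σ`
  refine ⟨Ideal.span (Set.range a), _, inferInstance, inferInstance, β, ?_⟩
  rw [IsLocalization.coeSubmodule_span, hN, hN₀, Submodule.map_span, ← Set.range_comp,
    ← Set.range_comp]
  congr 1
  refine congrArg Set.range (funext fun σ => ?_)
  simp only [Function.comp_apply, LinearMap.mulLeft_apply]
  exact hva σ

end Algebra

/-- **Restriction of Frobenius norm ideals** (Villamayor 3.4, "these morphisms patch"): for
nonempty affine opens `U ⊆ V` of an integral scheme and a Frobenius norm ideal `I ⊆ Γ(X, V)`,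
`I · Γ(X, U)` is a Frobenius norm ideal of `Γ(X, U)` — `U` is covered by basic opens `D(g)` of
`V` and `Γ(X, U) ⊆ Γ(X, D(g)) = Γ(X, V)[1/g]`. [cite: Villamayoru2006, 3.4] -/
theorem isFrobeniusNormIdeal_map_of_le {X : Scheme.{u}} [IsIntegral X] {p : ℕ}
    [ExpChar X.functionField p] {e : ℕ} {U V : X.affineOpens} (h : (U : X.Opens) ≤ V)
    [Nonempty (U : X.Opens)] [Nonempty (V : X.Opens)] {I : Ideal Γ(X, V)}
    (hI : IsFrobeniusNormIdeal X.functionField p e I) :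
    IsFrobeniusNormIdeal X.functionField p e (I.map (X.presheaf.map (homOfLE h).op).hom) := by
  letI alg : Algebra Γ(X, V) Γ(X, U) := (X.presheaf.map (homOfLE h).op).hom.toAlgebra
  haveI : IsScalarTower Γ(X, V) Γ(X, U) X.functionField :=
    IsScalarTower.of_algebraMap_eq fun a => by
      simp only [RingHom.algebraMap_toAlgebra]
      exact (X.presheaf.germ_res_apply (homOfLE h) _ _ a).symm
  refine hI.map_of_cover (A := Γ(X, V)) (A' := Γ(X, U))
    {g : Γ(X, V) | X.basicOpen g ≤ (U : X.Opens)} ?_ ?_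
  · -- the restrictions of the `g` with `D(g) ⊆ U` generate the unit ideal of `Γ(X, U)`
    rw [← U.2.self_le_iSup_basicOpen_iff]
    intro x hx
    obtain ⟨g, hgU, hxg⟩ := V.2.exists_basicOpen_le ⟨x, hx⟩ (h hx)
    refine Opens.mem_iSup.mpr ⟨⟨algebraMap Γ(X, V) Γ(X, U) g, g, hgU, rfl⟩, ?_⟩
    change x ∈ X.basicOpen (X.presheaf.map (homOfLE h).op g)
    rw [Scheme.basicOpen_res]
    exact ⟨hx, hxg⟩
  · -- `Γ(X, U) ⊆ Γ(X, V)[1/g]`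
    rintro g (hg : X.basicOpen g ≤ (U : X.Opens)) a'
    rcases ((X.basicOpen g : X.Opens) : Set X).eq_empty_or_nonempty with hW | hW
    · -- `D(g) = ∅`: `g` restricts to `0` on `U`
      have hbot : X.basicOpen g = ⊥ := SetLike.ext' hW
      have hg0 : algebraMap Γ(X, V) Γ(X, U) g = 0 := by
        rw [RingHom.algebraMap_toAlgebra, ← basicOpen_eq_bot_iff]
        change X.basicOpen (X.presheaf.map (homOfLE h).op g) = ⊥
        rw [Scheme.basicOpen_res, hbot, inf_bot_eq]
      exact ⟨1, 0, by rw [map_zero, hg0, pow_one, zero_mul]⟩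
    · obtain ⟨w, hw⟩ := hW
      haveI : Nonempty (X.basicOpen g) := ⟨⟨w, hw⟩⟩
      haveI := V.2.isLocalization_basicOpen g
      obtain ⟨⟨a, ⟨_, k, rfl⟩⟩, hak⟩ :=
        IsLocalization.surj (Submonoid.powers g) (X.presheaf.map (homOfLE hg).op a')
      refine ⟨k, a, map_injective_of_isIntegral X (homOfLE hg) ?_⟩
      have hcomp : ∀ z : Γ(X, V), X.presheaf.map (homOfLE hg).op (algebraMap Γ(X, V) Γ(X, U) z) =
          algebraMap Γ(X, V) Γ(X, X.basicOpen g) z := fun z => by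
        rw [RingHom.algebraMap_toAlgebra, RingHom.algebraMap_toAlgebra, ← CommRingCat.comp_apply,
          ← Functor.map_comp]
        rfl
      rw [map_mul, map_pow, hcomp, hcomp, ← hak, map_pow, mul_comm]

/-- Naturality of `U ≅ Spec Γ(X, U)` in the affine open `U`. [folklore] -/
theorem homOfLE_isoSpec_hom {X : Scheme.{u}} {U V : X.affineOpens} (h : (U : X.Opens) ≤ V) :
    X.homOfLE h ≫ V.2.isoSpec.hom =
      U.2.isoSpec.hom ≫ Spec.map (X.presheaf.map (homOfLE h).op) := by
  rw [← cancel_epi U.2.isoSpec.inv, U.2.isoSpec.inv_hom_id_assoc, ← cancel_mono V.2.isoSpec.inv,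
    Category.assoc, Category.assoc, V.2.isoSpec.hom_inv_id, Category.comp_id,
    ← cancel_mono (V : X.Opens).ι, Category.assoc, Scheme.homOfLE_ι, Category.assoc,
    IsAffineOpen.isoSpec_inv_ι, IsAffineOpen.isoSpec_inv_ι]
  exact (IsAffineOpen.map_fromSpec V.2 U.2 (homOfLE h).op).symm

/-- **The centre restricts**: for affine opens `U ⊆ V` and an ideal `I ⊆ Γ(X, V)`, the ideal
sheaf `Ĩ` (moved to `V`) pulls back along `U ↪ V` to the ideal sheaf of `I · Γ(X, U)` (moved to
`U`). [folklore] -/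
theorem comap_idealSheaf_homOfLE {X : Scheme.{u}} {U V : X.affineOpens} (h : (U : X.Opens) ≤ V)
    (I : Ideal Γ(X, V)) :
    ((affineBlowup.idealSheaf I).comap V.2.isoSpec.hom).comap (X.homOfLE h) =
      (affineBlowup.idealSheaf (I.map (X.presheaf.map (homOfLE h).op).hom)).comap
        U.2.isoSpec.hom := by
  rw [← Scheme.IdealSheafData.comap_comp, homOfLE_isoSpec_hom h,
    Scheme.IdealSheafData.comap_comp]
  congr 1
  exact comap_ofIdealTop_SpecMap (X.presheaf.map (homOfLE h).op).hom I

/-- **The local blowing ups are compatible** (Villamayor 3.4): a blowing up `π : B → U` of the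
affine open `U` along the Frobenius norm ideal `I_U` is, for every affine open `V ⊇ U`, a blowing
up along the restricted centre `Ĩ_V|_U` — on a nonempty `U` both `I_U` and `I_V · Γ(X, U)` are
Frobenius norm ideals, isomorphic fractional ideals with the same blowing ups.
[cite: Villamayoru2006, Thm. 3.3 and 3.4] -/
theorem isBlowup_comap_homOfLE {X : Scheme.{u}} [IsIntegral X] {p : ℕ}
    [ExpChar X.functionField p] {e : ℕ} (I : ∀ U : X.affineOpens, Ideal Γ(X, U))
    (hI : ∀ (U : X.affineOpens) [Nonempty (U : X.Opens)],
      IsFrobeniusNormIdeal X.functionField p e (I U))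
    {U V : X.affineOpens} (h : (U : X.Opens) ≤ V) {B : Scheme.{u}} {π : B ⟶ U}
    (hπ : IsBlowup π ((affineBlowup.idealSheaf (I U)).comap U.2.isoSpec.hom)) :
    IsBlowup π (((affineBlowup.idealSheaf (I V)).comap V.2.isoSpec.hom).comap (X.homOfLE h)) := by
  rw [comap_idealSheaf_homOfLE]
  suffices h' : IsBlowup (π ≫ U.2.isoSpec.hom)
      (affineBlowup.idealSheaf ((I V).map (X.presheaf.map (homOfLE h).op).hom)) by
    have := h'.comp_iso U.2.isoSpec.symm
    rwa [Iso.symm_hom, Iso.symm_inv, Category.assoc, Iso.hom_inv_id, Category.comp_id] at this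
  have h0 : IsBlowup (π ≫ U.2.isoSpec.hom) (affineBlowup.idealSheaf (I U)) := by
    have := hπ.comp_iso U.2.isoSpec
    rwa [← Scheme.IdealSheafData.comap_comp, Iso.inv_hom_id, Scheme.IdealSheafData.comap_id]
      at this
  rcases ((U : X.Opens) : Set X).eq_empty_or_nonempty with hU | hU
  · -- `U = ∅`: all ideals of the zero ring `Γ(X, U)` coincide
    have hUbot : (U : X.Opens) = ⊥ := SetLike.ext' hU
    haveI : Subsingleton Γ(X, U) :=
      CommRingCat.subsingleton_of_isTerminal (X.sheaf.isTerminalOfEqEmpty hUbot)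
    have : (I V).map (X.presheaf.map (homOfLE h).op).hom = I U :=
      Ideal.ext fun x => by rw [Subsingleton.elim x 0]; simp
    rwa [this]
  · obtain ⟨x, hx⟩ := hU
    haveI : Nonempty (U : X.Opens) := ⟨⟨x, hx⟩⟩
    haveI : Nonempty (V : X.Opens) := ⟨⟨x, h hx⟩⟩
    haveI : IsFractionRing Γ(X, U) X.functionField :=
      functionField_isFractionRing_of_isAffineOpen X U U.2
    have h1 := isFrobeniusNormIdeal_map_of_le h (hI V)
    obtain ⟨f, g, hf, hg, hfg⟩ := (hI U).exists_mul_eq_mul h1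
    exact (isBlowup_iff_of_span_singleton_mul_eq (hI U).ne_bot hf hg hfg).mp h0

/-- **The glued local F-blowups form an F-blowup**: if a relative gluing datum over the locally
directed affine cover of the integral scheme `X` consists of blowing ups of the affine opens `U`
along Frobenius norm ideals `I_U ⊆ Γ(X, U)`, the glued morphism is an `e`-th F-blowup — its
restriction over `U` is isomorphic to the `U`-th piece (Stacks 01LH).
[cite: Villamayoru2006, 3.4] -/
theorem isFBlowup_toBase_of_relativeGluingData {X : Scheme.{u}} [IsIntegral X] {p : ℕ}
    [ExpChar X.functionField p] {e : ℕ} (I : ∀ U : X.affineOpens, Ideal Γ(X, U))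
    (hI : ∀ (U : X.affineOpens) [Nonempty (U : X.Opens)],
      IsFrobeniusNormIdeal X.functionField p e (I U))
    (d : X.directedAffineCover.RelativeGluingData)
    (hd : ∀ U : X.affineOpens,
      IsBlowup (d.natTrans.app U) ((affineBlowup.idealSheaf (I U)).comap U.2.isoSpec.hom)) :
    IsFBlowup p e d.toBase := by
  refine ⟨fun U _ => ⟨I U, hI U, ?_⟩⟩
  have sq1 : IsPullback (d.natTrans.app U) (colimit.ι d.functor U) (U : X.Opens).ι d.toBase :=
    d.isPullback_natTrans_ι_toBase U
  have sq2 := isPullback_morphismRestrict d.toBase (U : X.Opens)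
  have hφ : (sq1.isoIsPullback _ _ sq2).inv ≫ d.natTrans.app U = d.toBase ∣_ (U : X.Opens) :=
    sq1.isoIsPullback_inv_fst _ _ sq2
  have h1 : IsBlowup (d.toBase ∣_ (U : X.Opens))
      ((affineBlowup.idealSheaf (I U)).comap U.2.isoSpec.hom) := by
    have := (hd U).iso_comp (sq1.isoIsPullback _ _ sq2).symm
    rwa [Iso.symm_hom, hφ] at this
  have := h1.comp_iso U.2.isoSpec
  rwa [← Scheme.IdealSheafData.comap_comp, Iso.inv_hom_id, Scheme.IdealSheafData.comap_id] at this

/-- **Gluing the local F-blowups** (Villamayor 2006, 3.4: "over each affine open, say `Spec(A)`,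
we blow up at some representative of `[[M]]` … it suffices to check that these morphisms
patch"; Yasuda 2012, Def. 2.2): if every nonempty affine open `U` of the integral scheme `X`
carries a Frobenius norm ideal `I_U = [[F^e_* Γ(X, U)]]`, then `X` has an `e`-th F-blowup: the
blowing ups `Bl_{I_U}(U) → U` (`exists_isBlowup`) are blowing ups along the restricted centres of
all larger affine opens (`isBlowup_comap_homOfLE`), so the universal property supplies cartesian
transition maps (`IsBlowup.isPullback_of_isOpenImmersion`), a relative gluing datum over the
locally directed affine cover. [cite: Villamayoru2006, Thm. 3.3 and 3.4; Yasuda2012, Def. 2.2] -/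
theorem exists_isFBlowup_of_forall_exists_isFrobeniusNormIdeal {X : Scheme.{u}} [IsIntegral X]
    (p : ℕ) [ExpChar X.functionField p] (e : ℕ)
    (hX : ∀ (U : X.affineOpens) [Nonempty (U : X.Opens)],
      ∃ I : Ideal Γ(X, U), IsFrobeniusNormIdeal X.functionField p e I) :
    ∃ (Y : Scheme.{u}) (π : Y ⟶ X), IsFBlowup p e π := by
  classical
  have hI' : ∀ U : X.affineOpens, ∃ I : Ideal Γ(X, U), ∀ [Nonempty (U : X.Opens)],
      IsFrobeniusNormIdeal X.functionField p e I := fun U => by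
    by_cases hU : Nonempty (U : X.Opens)
    · exact (hX U).imp fun I hI => hI
    · exact ⟨⊤, absurd ‹Nonempty _› hU⟩
  choose I hI using hI'
  -- the centres on the affine opens and their blowing ups
  let J : ∀ U : X.affineOpens, (U : Scheme.{u}).IdealSheafData := fun U =>
    (affineBlowup.idealSheaf (I U)).comap U.2.isoSpec.hom
  have hloc : ∀ U : X.affineOpens, ∃ (B : Scheme.{u}) (q : B ⟶ U), IsBlowup q (J U) :=
    fun U => exists_isBlowup _ _
  choose B q hq using hloc
  have hq' : ∀ {U V : X.affineOpens} (h : U ≤ V), IsBlowup (q U) ((J V).comap (X.homOfLE h)) :=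
    fun h => isBlowup_comap_homOfLE I (fun U => hI U) h (hq _)
  have hcart : ∀ {U V : X.affineOpens} (h : U ≤ V),
      IsEffectiveCartier ((J V).comap (q U ≫ X.homOfLE h)) := by
    intro U V h
    rw [Scheme.IdealSheafData.comap_comp]
    exact (hq' h).isEffectiveCartier
  let 𝒰 := X.directedAffineCover
  -- the functor of local blowing ups over the locally directed affine cover
  let F : 𝒰.I₀ ⥤ Scheme.{u} :=
    { obj := fun U => B U
      map := fun {U V} f => (hq V).lift (q U ≫ X.homOfLE f.le) (hcart f.le)
      map_id := fun U => by
        refine (hq U).hom_ext ?_ ?_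
        · rw [(hq U).lift_comp]; exact hcart le_rfl
        · rw [(hq U).lift_comp, Category.id_comp, Scheme.homOfLE_rfl, Category.comp_id]
      map_comp := fun {U V W} f g => by
        refine (hq W).hom_ext ?_ ?_
        · rw [(hq W).lift_comp]; exact hcart _
        · rw [(hq W).lift_comp, Category.assoc, (hq W).lift_comp, ← Category.assoc,
            (hq V).lift_comp, Category.assoc, Scheme.homOfLE_homOfLE] }
  -- the structure maps, a cartesian natural transformation
  let α : F ⟶ 𝒰.functorOfLocallyDirected :=
    { app := fun U => q U
      naturality := fun {U V} f => by
        change (hq V).lift (q U ≫ X.homOfLE f.le) (hcart f.le) ≫ q V = q U ≫ X.homOfLE f.le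
        rw [(hq V).lift_comp] }
  have hα : NatTrans.Equifibered α := by
    intro U V f
    change IsPullback ((hq V).lift (q U ≫ X.homOfLE f.le) (hcart f.le)) (q U) (q V)
      (X.homOfLE f.le)
    exact (hq V).isPullback_of_isOpenImmersion (X.homOfLE f.le) (hq' f.le) ((hq V).lift_comp _ _)
  let d : 𝒰.RelativeGluingData := ⟨F, α, hα⟩
  exact ⟨d.glued, d.toBase,
    isFBlowup_toBase_of_relativeGluingData I (fun U => hI U) d fun U => hq U⟩

/-- **Existence of F-blowups** (Yasuda 2012, Def. 2.2 / Cor. 2.6, in Villamayor's blow-up form,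
J. Algebra 295 (2006), Thm. 3.3 and 3.4): every integral separated scheme `X` of finite type
over a perfect field `k` of characteristic `p` admits an `e`-th F-blowup `g : Y → X`. The rings
`Γ(X, U)` of the nonempty affine opens are of finite type over the perfect field `k`, hence
F-finite, so they carry Frobenius norm ideals (`exists_isFrobeniusNormIdeal`) and the affine
blowing ups glue (`exists_isFBlowup_of_forall_exists_isFrobeniusNormIdeal`).
[cite: Yasuda2012, Def. 2.2 and Cor. 2.6; Villamayoru2006, Thm. 3.3 and 3.4] -/
theorem stub_fblowupExists :
    ∀ (p : ℕ) [Fact p.Prime] (k : Type) [Field k] [CharP k p] [PerfectField k]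
      (X : Scheme.{0}) (f : X ⟶ Spec (.of k)) [IsIntegral X] [IsSeparated f]
      [LocallyOfFiniteType f] [QuasiCompact f] [CharP X.functionField p] (e : ℕ), 0 < e →
      ∃ (Y : Scheme.{0}) (g : Y ⟶ X), IsFBlowup p e g := by
  intro p _ k _ _ _ X f _ _ _ _ _ e _
  refine exists_isFBlowup_of_forall_exists_isFrobeniusNormIdeal p e fun U hU => ?_
  haveI : IsFractionRing Γ(X, U) X.functionField :=
    functionField_isFractionRing_of_isAffineOpen X U U.2
  -- `Γ(X, U)` is of finite type over `Γ(Spec k, ⊤) ≅ k`, hence F-finite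
  letI alg : Algebra Γ(Spec (.of k), ⊤) Γ(X, U) := (f.appLE ⊤ (U : X.Opens) le_top).hom.toAlgebra
  haveI : Algebra.FiniteType Γ(Spec (.of k), ⊤) Γ(X, U) :=
    HasRingHomProperty.appLE @LocallyOfFiniteType f inferInstance ⟨⊤, isAffineOpen_top _⟩ U le_top
  haveI : ExpChar Γ(Spec (.of k), ⊤) p := expChar_of_injective_ringHom
    (Scheme.ΓSpecIso (.of k)).symm.commRingCatIsoToRingEquiv.injective p
  have hk : IsFFinite p e Γ(Spec (.of k), ⊤) :=
    (isFFinite_of_perfectRing k p e).of_surjective (Scheme.ΓSpecIso (.of k)).inv.hom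
      (Scheme.ΓSpecIso (.of k)).symm.commRingCatIsoToRingEquiv.surjective
  exact exists_isFrobeniusNormIdeal (hk.of_finiteType Γ(X, U))

end Summit.ResolutionOfSingularities.ResolutionOfSingularities.Theorems.WeightedThesis.KunzTower

end
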